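import Literature.Geometry.Lorentzian.MinkowskiGlobalHyperbolicity
import Summits.FinalStateConjecture.FinalStateConjecture.Theorems.SoloInformedHoleCount

/-!
# SoloInformed — future-complete rays cannot enter an uncharted future set

Soloist `solo-FinalStateConjecture-informed` (session 17, 2026-08-19). Kernel facts about the typed
SETTLING clauses `RaysStayInClosure`, `exteriorOf`, `HasExhaustiveCharts` of the summit
`FinalStateConjecture`, companion to `SoloInformedHoleCount.lean`. Only set algebra and the elementary
causality lemmas of `Literature` are used (time duality of `≪` and `≤`; no transitivity, no openness).

**The finding (paper/INTERIOR.md, (G11)).** `RaysStayInClosure 𝒟 O` quantifies over EVERY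
future-complete normalised null ray from EVERY point of the data hypersurface — all directions, in
particular the rays that cross an event horizon into a black hole. With `O = exteriorOf 𝒟 d.charted
= J⁺(ι X) ∩ I⁻(d.charted)` the clause therefore says: every event on a future-complete null ray from
`Σ` lies in `closure I⁻(d.charted)`, i.e. can (up to closure) send a timelike signal into the charted
near-Kerr / flat late region. Consequently:

1. **Structural form (no exhaustiveness needed).** If `W` is an open set closed under `I⁺`
   (`I⁺(W) ⊆ W`) which never meets the charted late region `d.charted`, then `W` is disjoint from
   `closure O` (`disjoint_closure_exteriorOf`), so NO future-complete normalised null ray from the data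
   meets `W` at a parameter `t ≥ 0`: a ray that enters `W` has bounded affine domain
   (`bddAbove_of_mem_of_disjoint_charted`). Region form: `Disjoint W 𝒟.completeNullRayRegion`
   (`disjoint_completeNullRayRegion_of_disjoint_charted`).
2. **Late form (with `HasExhaustiveCharts`).** The covering clause gives, for every chart time
   `τ ≥ τ₀`, `O ⊆ J⁻(lateCharted d τ)` where `lateCharted d τ` is the union of the chart images of the
   late regions `{t > τ}` (`subset_causalPast_lateCharted`); hence an open future set `W`
   (`J⁺(W) ⊆ W`) disjoint from the charts after SOME time `τ ≥ τ₀` already carries no future-complete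
   ray from the data (`bddAbove_of_mem_of_disjoint_lateCharted`).

In the intended witnesses (charts covering the domain of outer communications of a spacetime settling
to Kerr exteriors) `W` may be taken to be the interior of the black-hole region beyond the charts, and
items 1–2 read: **every null geodesic from `Σ` that enters the black-hole interior is future
affinely incomplete** — an interior statement (of strong-cosmic-censorship flavour) which the informal
final state conjecture ("disperse or settle down to finitely many Kerr black holes moving away from each
other", Dafermos–Luk arXiv:1710.01722, p. 8) does not make. It is a THEOREM for exact sub-extremal
Kerr (O'Neill 1995, Lemma 4.3.5–Prop. 4.3.9 and §4.4: in block II `ρ⁴ṙ² = ℙ² − Δ𝒦 > 0`, `r` is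
strictly monotone and reaches `r₋` at finite affine parameter), announced for two-ended near-Kerr
interiors (Dafermos–Luk arXiv:1710.01722, Thm. 3: every future-inextendible causal geodesic crosses
`𝓒𝓗⁺`), and open for generic one-ended collapse (ibid., p. 12).

References: O'Neill 1983, Ch. 14, pp. 402–403 (time duality); Hawking–Ellis 1973, §6.2;
O'Neill 1995, *The geometry of Kerr black holes*, §4.3–§4.4; [DafermosLuk2017] Conjecture 1, Thm. 3.
-/

open Literature.Geometry.Lorentzian
open scoped Manifold ContDiff Topology
open Filter Set

set_option linter.dupNamespace false

namespace Summit.FinalStateConjecture.FinalStateConjecture.Theorems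

/-! ### 1. The late charted region and the covering clause of `HasExhaustiveCharts` -/

section Decomposition

variable {𝓢 : Spacetime.{0} 4} {O : Set 𝓢.carrier} {k : ℕ}

/-- The **late charted region after chart time `τ`**: the flat chart's image of `{x⁰ > τ} ∩ U₀`
together with every hole chart's image of its late region `{t*ᵢ > τ}` (for `τ = τ₀` this is
`d.charted`). [cite: DafermosLuk2017, Conjecture 1 (b)] -/
def lateCharted (d : FinalStateDecomposition 𝓢 O k) (τ : ℝ) : Set 𝓢.carrier :=
  flatLate d τ ∪ ⋃ i, d.chart i '' (d.background i).lateRegion τ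

/-- At `τ = τ₀` the late charted region is the charted late region `d.charted`. [folklore] -/
theorem lateCharted_τ₀ (d : FinalStateDecomposition 𝓢 O k) : lateCharted d d.τ₀ = d.charted := rfl

/-- Late charted regions shrink with chart time. [folklore] -/
theorem lateCharted_mono (d : FinalStateDecomposition 𝓢 O k) {τ τ' : ℝ} (h : τ ≤ τ') :
    lateCharted d τ' ⊆ lateCharted d τ :=
  union_subset_union (flatLate_mono d h)
    (iUnion_mono fun i ↦ image_mono ((d.background i).lateRegion_mono h))

/-- Late charted regions after `τ ≥ τ₀` lie in the decomposed region `O`. [folklore] -/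
theorem lateCharted_subset (d : FinalStateDecomposition 𝓢 O k) {τ : ℝ} (h : d.τ₀ ≤ τ) :
    lateCharted d τ ⊆ O :=
  (lateCharted_mono d h).trans (by rw [lateCharted_τ₀]; exact d.charted_subset)

/-- The certified late region after `τ₁` lies in the late charted region after `τ₁` (near zones are
parts of the hole charts' late regions). [cite: DafermosLuk2017, Conjecture 1 (b)] -/
theorem certifiedLate_subset_lateCharted (d : FinalStateDecomposition 𝓢 O k)
    (R : Fin d.N → ℝ → ℝ) (τ₁ : ℝ) :
    Summit.FinalStateConjecture.certifiedLate d R τ₁ ⊆ lateCharted d τ₁ :=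
  union_subset_union le_rfl (iUnion_mono fun _ ↦ image_mono fun _ hx ↦ hx.1)

/-- The certified slab at `τ₁` lies in the late charted region after any earlier time `τ < τ₁`.
[cite: DafermosLuk2017, Conjecture 1 (b)] -/
theorem certifiedSlab_subset_lateCharted (d : FinalStateDecomposition 𝓢 O k)
    (R : Fin d.N → ℝ → ℝ) {τ τ₁ : ℝ} (h : τ < τ₁) :
    Summit.FinalStateConjecture.certifiedSlab d R τ₁ ⊆ lateCharted d τ :=
  union_subset_union (flatLeaf_subset_flatLate d h)
    (iUnion_mono fun i ↦ image_mono
      (((d.background i).truncTimeSlab_subset_timeSlab _ _).trans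
        ((d.background i).timeSlab_subset_lateRegion h)))

/-- **The covering clause, summed up: `O ⊆ J⁻(lateCharted d τ)` for every chart time `τ ≥ τ₀`.**
A point of `O` is either certified-late after `τ + 1` (hence in the late charted region after `τ`,
hence in its causal past) or, by `HasExhaustiveCharts`, in the causal past of the certified slab at
`τ + 1 ⊆ lateCharted d τ`. [cite: DafermosLuk2017, Conjecture 1 (b)–(c)] -/
theorem subset_causalPast_lateCharted (d : FinalStateDecomposition 𝓢 O k)
    (hex : Summit.FinalStateConjecture.HasExhaustiveCharts d) {τ : ℝ} (hτ : d.τ₀ ≤ τ) :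
    O ⊆ 𝓢.metric.causalPast 𝓢.timeOrientation (lateCharted d τ) := by
  obtain ⟨R, -, -, h⟩ := hex
  intro p hp
  have hτ1 : τ < τ + 1 := lt_add_one τ
  by_cases hl : p ∈ Summit.FinalStateConjecture.certifiedLate d R (τ + 1)
  · exact LorentzianMetric.subset_causalPast _ _ _
      (lateCharted_mono d hτ1.le (certifiedLate_subset_lateCharted d R (τ + 1) hl))
  · exact LorentzianMetric.causalFuture_mono (τ := 𝓢.timeOrientation.reverse)
      (certifiedSlab_subset_lateCharted d R hτ1) (h (τ + 1) (hτ.trans_lt hτ1) ⟨hp, hl⟩)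

/-- **A future set beyond the late charts misses `O`.** If `J⁺(W) ⊆ W` and `W` is disjoint from the
late charted region after some chart time `τ ≥ τ₀` of a decomposition with exhaustive charts, then
`W` is disjoint from `O`: a point `q ∈ W ∩ O` lies in `J⁻(lateCharted d τ)`, i.e. some chart point
`p` after `τ` lies in `J⁺(q) ⊆ J⁺(W) ⊆ W` — but the charts after `τ` never meet `W`. [folklore] -/
theorem disjoint_of_disjoint_lateCharted (d : FinalStateDecomposition 𝓢 O k)
    (hex : Summit.FinalStateConjecture.HasExhaustiveCharts d) {W : Set 𝓢.carrier}
    (hW : 𝓢.metric.causalFuture 𝓢.timeOrientation W ⊆ W) {τ : ℝ} (hτ : d.τ₀ ≤ τ)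
    (hdisj : Disjoint W (lateCharted d τ)) : Disjoint W O := by
  rw [disjoint_left]
  intro q hqW hqO
  have hq := subset_causalPast_lateCharted d hex hτ hqO
  rw [LorentzianMetric.causalPast, LorentzianMetric.causalFuture_eq_biUnion] at hq
  simp only [mem_iUnion, exists_prop] at hq
  obtain ⟨p, hpL, hqp⟩ := hq
  have hpq : p ∈ 𝓢.metric.causalFuture 𝓢.timeOrientation {q} :=
    LorentzianMetric.mem_causalPast_singleton_iff.1 hqp
  exact disjoint_left.1 hdisj
    (hW (LorentzianMetric.causalFuture_mono (singleton_subset_iff.2 hqW) hpq)) hpL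

/-- Same with the conclusion in closure form for an OPEN future set: `Disjoint W (closure O)`.
[folklore] -/
theorem disjoint_closure_of_disjoint_lateCharted (d : FinalStateDecomposition 𝓢 O k)
    (hex : Summit.FinalStateConjecture.HasExhaustiveCharts d) {W : Set 𝓢.carrier} (hWo : IsOpen W)
    (hW : 𝓢.metric.causalFuture 𝓢.timeOrientation W ⊆ W) {τ : ℝ} (hτ : d.τ₀ ≤ τ)
    (hdisj : Disjoint W (lateCharted d τ)) : Disjoint W (closure O) :=
  (disjoint_of_disjoint_lateCharted d hex hW hτ hdisj).closure_right hWo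

end Decomposition

/-! ### 2. The structural form: `exteriorOf 𝒟 U ⊆ I⁻(U)` -/

section Development

variable {X : Type} [TopologicalSpace X] [ChartedSpace E3 X] [IsManifold (𝓡 3) ∞ X]
  [ConnectedSpace X] {D : InitialDataSet (𝓡 3) X} {k : ℕ}

/-- The typed exterior determined by `U` lies in the chronological past of `U`. [folklore] -/
theorem exteriorOf_subset_chronologicalPast (𝒟 : CauchyDevelopment D) (U : Set 𝒟.carrier) :
    Summit.FinalStateConjecture.exteriorOf 𝒟 U ⊆
      𝒟.metric.chronologicalPast 𝒟.timeOrientation U :=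
  inter_subset_right

/-- **A chronological future set that never meets `U` misses the typed exterior of `U`**: if
`I⁺(W) ⊆ W` and `Disjoint W U` then `Disjoint W (exteriorOf 𝒟 U)` (a point `q ∈ W ∩ I⁻(U)` has some
`u ∈ U` with `u ∈ I⁺(q) ⊆ I⁺(W) ⊆ W`). O'Neill 1983, Ch. 14, p. 402 (time duality).
[cite: ONeill1983, Ch. 14  pp. 402–403] -/
theorem disjoint_exteriorOf (𝒟 : CauchyDevelopment D) {U W : Set 𝒟.carrier}
    (hW : 𝒟.metric.chronologicalFuture 𝒟.timeOrientation W ⊆ W) (hdisj : Disjoint W U) :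
    Disjoint W (Summit.FinalStateConjecture.exteriorOf 𝒟 U) := by
  rw [disjoint_left]
  rintro q hqW ⟨-, hqU⟩
  rw [LorentzianMetric.chronologicalPast, LorentzianMetric.chronologicalFuture_eq_biUnion] at hqU
  simp only [mem_iUnion, exists_prop] at hqU
  obtain ⟨u, huU, hqu⟩ := hqU
  have huq : u ∈ 𝒟.metric.chronologicalFuture 𝒟.timeOrientation {q} :=
    LorentzianMetric.mem_chronologicalFuture_of_mem_chronologicalPast hqu
  exact disjoint_left.1 hdisj
    (hW (LorentzianMetric.chronologicalFuture_mono (singleton_subset_iff.2 hqW) huq)) huU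

/-- Closure form for an OPEN chronological future set: `Disjoint W (closure (exteriorOf 𝒟 U))`.
[folklore] -/
theorem disjoint_closure_exteriorOf (𝒟 : CauchyDevelopment D) {U W : Set 𝒟.carrier}
    (hWo : IsOpen W) (hW : 𝒟.metric.chronologicalFuture 𝒟.timeOrientation W ⊆ W)
    (hdisj : Disjoint W U) :
    Disjoint W (closure (Summit.FinalStateConjecture.exteriorOf 𝒟 U)) :=
  (disjoint_exteriorOf 𝒟 hW hdisj).closure_right hWo

/-! ### 3. Future-complete rays cannot enter such sets -/

/-- **`RaysStayInClosure` keeps the complete-ray region out of every open set missing `closure O`.**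
[cite: arXiv08110354, §2.5.4] -/
theorem disjoint_completeNullRayRegion (𝒟 : CauchyDevelopment D) [𝒟.metric.HasLeviCivita]
    {O W : Set 𝒟.carrier} (hrays : Summit.FinalStateConjecture.RaysStayInClosure 𝒟 O)
    (hdisj : Disjoint W (closure O)) : Disjoint W 𝒟.completeNullRayRegion :=
  hdisj.mono_right ((raysStayInClosure_iff 𝒟 O).1 hrays)

/-- **Ray form: a normalised null ray from the data that meets, at a parameter `t ≥ 0`, a set `W`
disjoint from `closure O` has bounded affine domain** (it is NOT future-complete).
[cite: arXiv08110354, §2.5.4] -/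
theorem bddAbove_of_mem (𝒟 : CauchyDevelopment D) [𝒟.metric.HasLeviCivita]
    {O W : Set 𝒟.carrier} (hrays : Summit.FinalStateConjecture.RaysStayInClosure 𝒟 O)
    (hdisj : Disjoint W (closure O)) {p : X} {γ : ℝ → 𝒟.carrier} {dom : Set ℝ}
    (hγ : 𝒟.metric.IsNormalisedNullRayFrom 𝒟.timeOrientation 𝒟.embed 𝒟.normal p γ dom)
    {t : ℝ} (ht : t ∈ dom) (h0 : 0 ≤ t) (hγt : γ t ∈ W) : BddAbove dom := by
  by_contra hna
  exact disjoint_left.1 hdisj hγt (hrays p γ dom hγ hna t ht h0)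

/-- **(G11), structural form.** In the summit's shape `O = exteriorOf 𝒟 d.charted` with
`RaysStayInClosure 𝒟 O`: an open set `W` with `I⁺(W) ⊆ W` that never meets the charted late region
`d.charted` carries no event `γ t`, `t ≥ 0`, of a future-complete normalised null ray from the data —
a ray entering `W` has bounded affine domain. For the intended witnesses (`W` = the black-hole interior
beyond the charts): every null geodesic from `Σ` entering the black hole is future-incomplete.
O'Neill 1995, §4.3–§4.4 (true in exact Kerr); [DafermosLuk2017] Thm. 3 (two-ended near-Kerr).
[cite: DafermosLuk2017, Conjecture 1] -/
theorem bddAbove_of_mem_of_disjoint_charted (𝒟 : CauchyDevelopment D) [𝒟.metric.HasLeviCivita]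
    {O : Set 𝒟.carrier} (d : FinalStateDecomposition 𝒟.toSpacetime O k)
    (hO : O = Summit.FinalStateConjecture.exteriorOf 𝒟 d.charted)
    (hrays : Summit.FinalStateConjecture.RaysStayInClosure 𝒟 O) {W : Set 𝒟.carrier}
    (hWo : IsOpen W) (hW : 𝒟.metric.chronologicalFuture 𝒟.timeOrientation W ⊆ W)
    (hdisj : Disjoint W d.charted) {p : X} {γ : ℝ → 𝒟.carrier} {dom : Set ℝ}
    (hγ : 𝒟.metric.IsNormalisedNullRayFrom 𝒟.timeOrientation 𝒟.embed 𝒟.normal p γ dom)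
    {t : ℝ} (ht : t ∈ dom) (h0 : 0 ≤ t) (hγt : γ t ∈ W) : BddAbove dom := by
  exact bddAbove_of_mem 𝒟 hrays
    ((disjoint_closure_exteriorOf 𝒟 hWo hW hdisj).mono_right (congrArg closure hO).le) hγ ht h0 hγt

/-- Region form of the structural (G11): `Disjoint W 𝒟.completeNullRayRegion`. [cite: DafermosLuk2017, Conjecture 1] -/
theorem disjoint_completeNullRayRegion_of_disjoint_charted (𝒟 : CauchyDevelopment D)
    [𝒟.metric.HasLeviCivita] {O : Set 𝒟.carrier} (d : FinalStateDecomposition 𝒟.toSpacetime O k)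
    (hO : O = Summit.FinalStateConjecture.exteriorOf 𝒟 d.charted)
    (hrays : Summit.FinalStateConjecture.RaysStayInClosure 𝒟 O) {W : Set 𝒟.carrier}
    (hWo : IsOpen W) (hW : 𝒟.metric.chronologicalFuture 𝒟.timeOrientation W ⊆ W)
    (hdisj : Disjoint W d.charted) : Disjoint W 𝒟.completeNullRayRegion := by
  exact disjoint_completeNullRayRegion 𝒟 hrays
    ((disjoint_closure_exteriorOf 𝒟 hWo hW hdisj).mono_right (congrArg closure hO).le)

/-- **(G11), late form.** With exhaustive charts it suffices that the open future set `W`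
(`J⁺(W) ⊆ W`) misses the charts after SOME chart time `τ ≥ τ₀`: then no future-complete normalised
null ray from the data meets `W` at a parameter `t ≥ 0`. [cite: DafermosLuk2017, Conjecture 1 (b)–(c)] -/
theorem bddAbove_of_mem_of_disjoint_lateCharted (𝒟 : CauchyDevelopment D) [𝒟.metric.HasLeviCivita]
    {O : Set 𝒟.carrier} (d : FinalStateDecomposition 𝒟.toSpacetime O k)
    (hrays : Summit.FinalStateConjecture.RaysStayInClosure 𝒟 O)
    (hex : Summit.FinalStateConjecture.HasExhaustiveCharts d) {W : Set 𝒟.carrier}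
    (hWo : IsOpen W) (hW : 𝒟.metric.causalFuture 𝒟.timeOrientation W ⊆ W) {τ : ℝ}
    (hτ : d.τ₀ ≤ τ) (hdisj : Disjoint W (lateCharted d τ)) {p : X} {γ : ℝ → 𝒟.carrier}
    {dom : Set ℝ}
    (hγ : 𝒟.metric.IsNormalisedNullRayFrom 𝒟.timeOrientation 𝒟.embed 𝒟.normal p γ dom)
    {t : ℝ} (ht : t ∈ dom) (h0 : 0 ≤ t) (hγt : γ t ∈ W) : BddAbove dom :=
  bddAbove_of_mem 𝒟 hrays (disjoint_closure_of_disjoint_lateCharted d hex hWo hW hτ hdisj)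
    hγ ht h0 hγt

/-- Region form of the late (G11): `Disjoint W 𝒟.completeNullRayRegion`.
[cite: DafermosLuk2017, Conjecture 1 (b)–(c)] -/
theorem disjoint_completeNullRayRegion_of_disjoint_lateCharted (𝒟 : CauchyDevelopment D)
    [𝒟.metric.HasLeviCivita] {O : Set 𝒟.carrier} (d : FinalStateDecomposition 𝒟.toSpacetime O k)
    (hrays : Summit.FinalStateConjecture.RaysStayInClosure 𝒟 O)
    (hex : Summit.FinalStateConjecture.HasExhaustiveCharts d) {W : Set 𝒟.carrier}
    (hWo : IsOpen W) (hW : 𝒟.metric.causalFuture 𝒟.timeOrientation W ⊆ W) {τ : ℝ}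
    (hτ : d.τ₀ ≤ τ) (hdisj : Disjoint W (lateCharted d τ)) :
    Disjoint W 𝒟.completeNullRayRegion :=
  disjoint_completeNullRayRegion 𝒟 hrays
    (disjoint_closure_of_disjoint_lateCharted d hex hWo hW hτ hdisj)

end Development

end Summit.FinalStateConjecture.FinalStateConjecture.Theorems
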